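import Summits.QuantumFields.BalabanUV.Beta.GAN24.ContactAssembly

/-!
# `BalabanUV.Beta.GAN24.ContactCauchyCells` — binder row G-an2-4 / (CONV-C), the row owner's CONTACT-TERM ROUTE, **CT-4e part 1** (`gen19/CT4-DESIGN-v0.md` §3,
# leaf-01 g61's `CT4CE-BLUEPRINT-v0.md` §0 ∕ M6): **THE CONTACT TERM OF MEMBER `k` AS THE EXACT SIGNED COMBINATION OF ITS ATOMS** — six B-atoms (gauge
# reading × undressed leg × tent; tip ∕ midpoint ∕ site weights) and twelve P-atoms (tent × gauge reading × gauge jump; tip ∕ midpoint readings, one per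
# direction), every one in the spelling of the two-tower atom ENDs of CT-4c (leaf-02 g50's `ContactRefineBHolds.exists_atomTip∕Mid∕Site_refine_three`,
# gan24-p2 g34's `ContactRefinePThreePack.exists_pairingAtomTip∕Mid_refine_three`).

NOT IN PRINT; OUR BOOKKEEPING (row owner `b2b-balaban-gan24-p1`, gen 22; journal [GAN24P1-G22-ONLINE]).  [folklore] EQUALITIES only: leaf-01 g58's
`ContactKernelCells.contact_legChain_ff_eq_cells` (CONTACT = LEFT − RIGHT + TABLE cell), leaf-02's cell identities `ContactOneGaugeCellTable.cell_eq'` ∕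
`cellIdx_eq'`, leaf-01's `ContactCellSplit.split_tip` ∕ `split_mid`, and the letters of `ContactAssembly.exists_common_letters` (used ONLY qualitatively:
boundedness and summability, so that the Fubini-type identities apply).  HONEST FRAMING (cell contract, verbatim): «discharging `BetaPertH` makes Bałaban's
UV stability UNCONDITIONAL — a real constructive-QFT result; it is NOT the continuum limit and NOT the Clay problem.»  HONEST DEPENDENCY (verbatim): «continuum
YM on T⁴ ⇐ BetaPertH ∧ nine spine estimates (0/9 proved); BetaPertH ⇐ (D1) ∧ (D4) ∧ CAP+tail; G-an2-4 gates asym, D1 and NE2/3/4.»  0 `def`, 0 cited facts,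
0 `def … : Prop`, 0 sorry.  NO estimate; discharges NOTHING of (hS, hSall) on (E) by itself (CT-4e part 2 `ContactCauchyAssembly` differences the atoms across
two consecutive towers with the CT-4c ENDs); 0 wall binders; NEVER «G-an2-4 closed» as (CONV-C); NOT D1, NOT BetaPertH, NOT continuum, NOT Clay.

## What is proved
* §1 (generic `d`, abstract partners) **`cellL_eq_atoms`**, **`cellR_eq_atoms`** — the LEFT-type ∕ RIGHT-type one-gauge cell as `½(B-atom_tip + Σ_κ P-atom_tip,κ)
  − ½(B-atom_mid + Σ_b P-atom_mid,b)` resp. `… − ½·B-atom_mid` (sup hypotheses only); the TABLE cell is leaf-02's `cellIdx_eq'` as it stands.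
* §2 (`d = 3`, `2 ≤ Lc`, in-block root `ρ = toSite rr`, `m = 0`) **`contact_eq_atoms`**: for every `k κ′ u′ x′ z′ α β`,
  `push₃ T T T (wilsonA 3) κ′ u′ x′ z′ (inl α) (inl β) − push₃ B B B (wilsonA 3) κ′ u′ x′ z′ (inl α) (inl β)` (`T = legChain (respStepBmSeq ρ Lc) 0 k`,
  `B = respStep 1 (Lc^(k+1))`) `=` the displayed signed combination of atoms with gauge functions `λ_{μ,z} = Psi ρ Lc 0 k (delta1 μ z) − bmGaugeAt ρ (B μ z) Lc`,
  legs `B μ z κ x`, tents `t_{μ,z} κ x = contourSumAdj (Lc^(k+1)) (fun l y ↦ wΦ l μ (y − z)) κ x` (B6 `unitVec`).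
Unit `b2b-balaban-gan24-p1` (row owner G-an2-4, gen 22), 2026-08-21.
-/

noncomputable section

open Finset
open scoped BigOperators
open Literature.MathematicalPhysics.QuantumFieldTheory
open Literature.MathematicalPhysics.QuantumFieldTheory.LatticeForm (quo)
open Literature.MathematicalPhysics.QuantumFieldTheory.Balaban1983to89
open Literature.MathematicalPhysics.QuantumFieldTheory.Balaban1983to89.Beta
open B4ContourShift (supNorm supNorm_nonneg)
open StepJetData (wilsonA)
open AffineAveraging (Form0 Form1 Site box toSite curv curvAdj)
open AffineReproduction (contourSumAdj)
open KernelSpecInstance (wΦ)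
open B6BondElimination (unitVec)
open KKTFluctuationKernel (delta1)
open BalabanCompositeJets (respStep)
open Summit.QuantumFields.BalabanUV.Beta.AxialProjectorBlockMean (bmGaugeAt)
open Summit.QuantumFields.BalabanUV.Beta.GAN24.Push4Iter (LegFam legChain)
open Summit.QuantumFields.BalabanUV.Beta.GAN24.RespStepBmDecompExact (respStepBmSeq)
open Summit.QuantumFields.BalabanUV.Beta.GAN24.RespStepBmDecompPsi (Psi)
open Summit.QuantumFields.BalabanUV.Beta.GAN24.Push3 (push₃)
open Summit.QuantumFields.BalabanUV.Beta.GAN24.ContactOneGaugeCellBound (abs_le_of_env summable_of_env)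
open Summit.QuantumFields.BalabanUV.Beta.GAN24.ContactOneGaugeCellTable (cell_eq' cellIdx_eq')
open Summit.QuantumFields.BalabanUV.Beta.GAN24.ContactCellSplit (split_tip split_mid)
open Summit.QuantumFields.BalabanUV.Beta.GAN24.ContactCellReduction (abs_le_of_env₁ summable_of_env₁)
open Summit.QuantumFields.BalabanUV.Beta.GAN24.ContactKernelCells (contact_legChain_ff_eq_cells)
open Summit.QuantumFields.BalabanUV.Beta.GAN24.ContactPartnerLetters (curvAdj_curv_respStep_one_eq_contourSumAdj respStep_pow_zero)
open Summit.QuantumFields.BalabanUV.Beta.GAN24.ContactCellLetters (abs_gauge_le legChain_apply_eq curvAdj_curv_legChain_zero_eq_contourSumAdj)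
open Summit.QuantumFields.BalabanUV.Beta.GAN24.ContactAssembly (exists_common_letters)

namespace Summit.QuantumFields.BalabanUV.Beta.GAN24.ContactCauchyCells

/-! ## §1 The one-gauge cells as signed combinations of atoms (generic `d`, abstract partners) -/

section Generic

variable {d : ℕ} {ψ lam₁ lam₃ : Form0 (d + 1) ℝ} {T₁ T₃ B₁ B₃ M₁ M₃ : Form1 (d + 1) ℝ} {Bψ BT₁ BB₁ BB₃ Bg₁ Bg₃ BM₁ : ℝ}

/-- NOT IN PRINT; OUR BOOKKEEPING.  **THE LEFT-TYPE CELL AS ATOMS** (both partners dressed: `T₁ = B₁ + dλ₁` read in the TIP position, `T₃ = B₃ + dλ₃` in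
the MIDPOINT position; Maxwell operators `d*dT₁ = M₁`, `d*dT₃ = M₃`; sup hypotheses only):
`cell = ½(Σ'Σ ψ_tip·B₁·M₃ + Σ_κ Σ' M₃·ψ_tip·Δ_κλ₁) − ½(Σ'Σ ψ_mid·B₃·M₁ + Σ_b Σ' M₁·ψ_mid·Δ_bλ₃)` (leaf-02's `cell_eq'`, then leaf-01's `split_tip` ∕
`split_mid`). -/
theorem cellL_eq_atoms (hT₃s : ∀ b, Summable (T₃ b)) (hM₁s : ∀ b, Summable (M₁ b)) (hM₃s : ∀ κ, Summable (M₃ κ))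
    (hψ : ∀ x, |ψ x| ≤ Bψ) (hT₁b : ∀ κ u, |T₁ κ u| ≤ BT₁) (hB₁ : ∀ κ u, |B₁ κ u| ≤ BB₁) (hB₃ : ∀ b z, |B₃ b z| ≤ BB₃)
    (hg₁ : ∀ x, |lam₁ x| ≤ Bg₁) (hg₃ : ∀ x, |lam₃ x| ≤ Bg₃) (hM₁b : ∀ b z, |M₁ b z| ≤ BM₁)
    (hT₁ : ∀ κ u, T₁ κ u = B₁ κ u + (lam₁ (u + unitVec κ) - lam₁ u)) (hT₃ : ∀ b z, T₃ b z = B₃ b z + (lam₃ (z + unitVec b) - lam₃ z))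
    (hM₁ : curvAdj (curv T₁) = M₁) (hM₃ : curvAdj (curv T₃) = M₃) :
    ∑' z, ∑ b, T₃ b z *
        ∑' u, ∑ κ, T₁ κ u * ((1 / 2 : ℝ) * (ψ (u + unitVec κ) - (ψ z + ψ (z + unitVec b)) / 2) * curvAdj (curv (delta1 κ u)) b z)
      = (1 / 2 : ℝ) * ((∑' u, ∑ κ, ψ (u + unitVec κ) * B₁ κ u * M₃ κ u)
          + ∑ κ, ∑' u, M₃ κ u * ψ (u + unitVec κ) * (lam₁ (u + unitVec κ) - lam₁ u))
        - (1 / 2 : ℝ) * ((∑' z, ∑ b, (ψ z + ψ (z + unitVec b)) / 2 * B₃ b z * M₁ b z)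
          + ∑ b, ∑' z, M₁ b z * ((ψ z + ψ (z + unitVec b)) / 2) * (lam₃ (z + unitVec b) - lam₃ z)) := by
  have hM₁b' : ∀ b z, |curvAdj (curv T₁) b z| ≤ BM₁ := fun b z => by rw [hM₁]; exact hM₁b b z
  rw [cell_eq' hT₃s hψ hT₁b hM₁b', hM₁, hM₃]
  have eA : (∑' u, ∑ κ, ψ (u + unitVec κ) * T₁ κ u * M₃ κ u)
      = ∑' u, ∑ κ, ψ (u + unitVec κ) * (B₁ κ u + (lam₁ (u + unitVec κ) - lam₁ u)) * M₃ κ u :=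
    tsum_congr fun u => Finset.sum_congr rfl fun κ _ => by rw [hT₁]
  have eB : (∑' z, ∑ b, (ψ z + ψ (z + unitVec b)) / 2 * T₃ b z * M₁ b z)
      = ∑' z, ∑ b, (ψ z + ψ (z + unitVec b)) / 2 * (B₃ b z + (lam₃ (z + unitVec b) - lam₃ z)) * M₁ b z :=
    tsum_congr fun z => Finset.sum_congr rfl fun b _ => by rw [hT₃]
  rw [eA, eB, split_tip hM₃s hψ hB₁ hg₁, split_mid hM₁s hψ hB₃ hg₃]

/-- NOT IN PRINT; OUR BOOKKEEPING.  **THE RIGHT-TYPE CELL AS ATOMS** (outer partner `B₃` UNDRESSED, `d*dB₃ = M₃`; inner partner `T₁ = B₁ + dλ₁` dressed in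
the TIP position): `cell = ½(Σ'Σ ψ_tip·B₁·M₃ + Σ_κ Σ' M₃·ψ_tip·Δ_κλ₁) − ½·Σ'Σ ψ_mid·B₃·M₁`. -/
theorem cellR_eq_atoms (hB₃s : ∀ b, Summable (B₃ b)) (hM₃s : ∀ κ, Summable (M₃ κ))
    (hψ : ∀ x, |ψ x| ≤ Bψ) (hT₁b : ∀ κ u, |T₁ κ u| ≤ BT₁) (hB₁ : ∀ κ u, |B₁ κ u| ≤ BB₁) (hg₁ : ∀ x, |lam₁ x| ≤ Bg₁)
    (hM₁b : ∀ b z, |M₁ b z| ≤ BM₁)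
    (hT₁ : ∀ κ u, T₁ κ u = B₁ κ u + (lam₁ (u + unitVec κ) - lam₁ u))
    (hM₁ : curvAdj (curv T₁) = M₁) (hM₃ : curvAdj (curv B₃) = M₃) :
    ∑' z, ∑ b, B₃ b z *
        ∑' u, ∑ κ, T₁ κ u * ((1 / 2 : ℝ) * (ψ (u + unitVec κ) - (ψ z + ψ (z + unitVec b)) / 2) * curvAdj (curv (delta1 κ u)) b z)
      = (1 / 2 : ℝ) * ((∑' u, ∑ κ, ψ (u + unitVec κ) * B₁ κ u * M₃ κ u)
          + ∑ κ, ∑' u, M₃ κ u * ψ (u + unitVec κ) * (lam₁ (u + unitVec κ) - lam₁ u))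
        - (1 / 2 : ℝ) * (∑' z, ∑ b, (ψ z + ψ (z + unitVec b)) / 2 * B₃ b z * M₁ b z) := by
  have hM₁b' : ∀ b z, |curvAdj (curv T₁) b z| ≤ BM₁ := fun b z => by rw [hM₁]; exact hM₁b b z
  rw [cell_eq' hB₃s hψ hT₁b hM₁b', hM₁, hM₃]
  have eA : (∑' u, ∑ κ, ψ (u + unitVec κ) * T₁ κ u * M₃ κ u)
      = ∑' u, ∑ κ, ψ (u + unitVec κ) * (B₁ κ u + (lam₁ (u + unitVec κ) - lam₁ u)) * M₃ κ u :=
    tsum_congr fun u => Finset.sum_congr rfl fun κ _ => by rw [hT₁]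
  rw [eA, split_tip hM₃s hψ hB₁ hg₁]

end Generic

/-! ## §2 The contact term of member `k` as atoms (`d = 3`, `m = 0`) -/

section Three

variable {Lc : ℕ} [NeZero Lc] {rr : Fin (3 + 1) → ℕ}

/-- NOT IN PRINT; OUR BOOKKEEPING.  **THE CONTACT TERM OF MEMBER `k` OF THE CUBIC-WILSON SECTOR AS THE EXACT SIGNED COMBINATION OF ITS ATOMS**
(`d = 3`, `2 ≤ Lc`, in-block root `ρ = toSite rr`; `T = legChain (respStepBmSeq ρ Lc) 0 k`, `B = respStep 1 (Lc^(k+1))`, gauge functions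
`λ_{μ,z} = Psi ρ Lc 0 k (delta1 μ z) − bmGaugeAt ρ (B μ z) Lc`, tents `t_{μ,z} = contourSumAdj (Lc^(k+1)) (fun l y ↦ wΦ l μ (y − z))`):
`CONTACT = [½(A_tip(λ_{αx′}; B_{κ′u′}; t_{βz′}) + Σ_κ P_tip,κ(t_{βz′}; λ_{αx′}; λ_{κ′u′})) − ½(A_mid(λ_{αx′}; B_{βz′}; t_{κ′u′}) + Σ_b P_mid,b(t_{κ′u′}; λ_{αx′}; λ_{βz′}))]`
`− [½(A_tip(λ_{βz′}; B_{κ′u′}; t_{αx′}) + Σ_κ P_tip,κ(t_{αx′}; λ_{βz′}; λ_{κ′u′})) − ½·A_mid(λ_{βz′}; B_{αx′}; t_{κ′u′})]`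
`+ [½·A_site(λ_{κ′u′}; B_{βz′}; t_{αx′}) − ½·A_site(λ_{κ′u′}; B_{αx′}; t_{βz′})]` — leaf-01 g58's three cells + §1 + leaf-02's `cellIdx_eq'`. -/
theorem contact_eq_atoms (hLc : 2 ≤ Lc) (hrr : rr ∈ box (3 + 1) Lc) (k : ℕ) (κ' : Fin (3 + 1)) (u' x' z' : Site (3 + 1)) (α β : Fin (3 + 1)) :
    push₃ (legChain (respStepBmSeq (d := 3) (toSite rr) Lc) 0 k) (legChain (respStepBmSeq (d := 3) (toSite rr) Lc) 0 k)
        (legChain (respStepBmSeq (d := 3) (toSite rr) Lc) 0 k) (wilsonA 3) κ' u' x' z' (Sum.inl α) (Sum.inl β)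
      - push₃ (respStep (d := 3) 1 (Lc ^ (k + 1))) (respStep (d := 3) 1 (Lc ^ (k + 1))) (respStep (d := 3) 1 (Lc ^ (k + 1)))
        (wilsonA 3) κ' u' x' z' (Sum.inl α) (Sum.inl β)
      = ((1 / 2 : ℝ) * ((∑' x : Site (3 + 1), ∑ κ,
              (Psi (toSite rr) Lc 0 k (delta1 α x') - bmGaugeAt (toSite rr) (respStep (d := 3) 1 (Lc ^ (k + 1)) α x') Lc) (x + unitVec κ)
                * respStep (d := 3) 1 (Lc ^ (k + 1)) κ' u' κ x
                * contourSumAdj (Lc ^ (k + 1)) (fun l y => wΦ (N := Lc ^ (k + 1)) (d := 3) l β (y - z')) κ x)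
            + ∑ κ, ∑' v : Site (3 + 1), contourSumAdj (Lc ^ (k + 1)) (fun l y => wΦ (N := Lc ^ (k + 1)) (d := 3) l β (y - z')) κ v
                * (Psi (toSite rr) Lc 0 k (delta1 α x') - bmGaugeAt (toSite rr) (respStep (d := 3) 1 (Lc ^ (k + 1)) α x') Lc) (v + unitVec κ)
                * ((Psi (toSite rr) Lc 0 k (delta1 κ' u') - bmGaugeAt (toSite rr) (respStep (d := 3) 1 (Lc ^ (k + 1)) κ' u') Lc) (v + unitVec κ)
                  - (Psi (toSite rr) Lc 0 k (delta1 κ' u') - bmGaugeAt (toSite rr) (respStep (d := 3) 1 (Lc ^ (k + 1)) κ' u') Lc) v))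
          - (1 / 2 : ℝ) * ((∑' x : Site (3 + 1), ∑ κ,
              ((Psi (toSite rr) Lc 0 k (delta1 α x') - bmGaugeAt (toSite rr) (respStep (d := 3) 1 (Lc ^ (k + 1)) α x') Lc) x
                  + (Psi (toSite rr) Lc 0 k (delta1 α x') - bmGaugeAt (toSite rr) (respStep (d := 3) 1 (Lc ^ (k + 1)) α x') Lc) (x + unitVec κ)) / 2
                * respStep (d := 3) 1 (Lc ^ (k + 1)) β z' κ x
                * contourSumAdj (Lc ^ (k + 1)) (fun l y => wΦ (N := Lc ^ (k + 1)) (d := 3) l κ' (y - u')) κ x)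
            + ∑ κ, ∑' v : Site (3 + 1), contourSumAdj (Lc ^ (k + 1)) (fun l y => wΦ (N := Lc ^ (k + 1)) (d := 3) l κ' (y - u')) κ v
                * (((Psi (toSite rr) Lc 0 k (delta1 α x') - bmGaugeAt (toSite rr) (respStep (d := 3) 1 (Lc ^ (k + 1)) α x') Lc) v
                    + (Psi (toSite rr) Lc 0 k (delta1 α x') - bmGaugeAt (toSite rr) (respStep (d := 3) 1 (Lc ^ (k + 1)) α x') Lc) (v + unitVec κ)) / 2)
                * ((Psi (toSite rr) Lc 0 k (delta1 β z') - bmGaugeAt (toSite rr) (respStep (d := 3) 1 (Lc ^ (k + 1)) β z') Lc) (v + unitVec κ)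
                  - (Psi (toSite rr) Lc 0 k (delta1 β z') - bmGaugeAt (toSite rr) (respStep (d := 3) 1 (Lc ^ (k + 1)) β z') Lc) v)))
        - ((1 / 2 : ℝ) * ((∑' x : Site (3 + 1), ∑ κ,
              (Psi (toSite rr) Lc 0 k (delta1 β z') - bmGaugeAt (toSite rr) (respStep (d := 3) 1 (Lc ^ (k + 1)) β z') Lc) (x + unitVec κ)
                * respStep (d := 3) 1 (Lc ^ (k + 1)) κ' u' κ x
                * contourSumAdj (Lc ^ (k + 1)) (fun l y => wΦ (N := Lc ^ (k + 1)) (d := 3) l α (y - x')) κ x)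
            + ∑ κ, ∑' v : Site (3 + 1), contourSumAdj (Lc ^ (k + 1)) (fun l y => wΦ (N := Lc ^ (k + 1)) (d := 3) l α (y - x')) κ v
                * (Psi (toSite rr) Lc 0 k (delta1 β z') - bmGaugeAt (toSite rr) (respStep (d := 3) 1 (Lc ^ (k + 1)) β z') Lc) (v + unitVec κ)
                * ((Psi (toSite rr) Lc 0 k (delta1 κ' u') - bmGaugeAt (toSite rr) (respStep (d := 3) 1 (Lc ^ (k + 1)) κ' u') Lc) (v + unitVec κ)
                  - (Psi (toSite rr) Lc 0 k (delta1 κ' u') - bmGaugeAt (toSite rr) (respStep (d := 3) 1 (Lc ^ (k + 1)) κ' u') Lc) v))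
          - (1 / 2 : ℝ) * (∑' x : Site (3 + 1), ∑ κ,
              ((Psi (toSite rr) Lc 0 k (delta1 β z') - bmGaugeAt (toSite rr) (respStep (d := 3) 1 (Lc ^ (k + 1)) β z') Lc) x
                  + (Psi (toSite rr) Lc 0 k (delta1 β z') - bmGaugeAt (toSite rr) (respStep (d := 3) 1 (Lc ^ (k + 1)) β z') Lc) (x + unitVec κ)) / 2
                * respStep (d := 3) 1 (Lc ^ (k + 1)) α x' κ x
                * contourSumAdj (Lc ^ (k + 1)) (fun l y => wΦ (N := Lc ^ (k + 1)) (d := 3) l κ' (y - u')) κ x))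
        + ((1 / 2 : ℝ) * (∑' x : Site (3 + 1), ∑ κ,
              (Psi (toSite rr) Lc 0 k (delta1 κ' u') - bmGaugeAt (toSite rr) (respStep (d := 3) 1 (Lc ^ (k + 1)) κ' u') Lc) x
                * respStep (d := 3) 1 (Lc ^ (k + 1)) β z' κ x
                * contourSumAdj (Lc ^ (k + 1)) (fun l y => wΦ (N := Lc ^ (k + 1)) (d := 3) l α (y - x')) κ x)
          - (1 / 2 : ℝ) * (∑' x : Site (3 + 1), ∑ κ,
              (Psi (toSite rr) Lc 0 k (delta1 κ' u') - bmGaugeAt (toSite rr) (respStep (d := 3) 1 (Lc ^ (k + 1)) κ' u') Lc) x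
                * respStep (d := 3) 1 (Lc ^ (k + 1)) α x' κ x
                * contourSumAdj (Lc ^ (k + 1)) (fun l y => wΦ (N := Lc ^ (k + 1)) (d := 3) l β (y - z')) κ x)) := by
  haveI : NeZero (Lc ^ (k + 1)) := ⟨pow_ne_zero _ (NeZero.ne Lc)⟩
  have hL1 : 1 ≤ Lc := by omega
  have hN1' : 1 ≤ Lc ^ (k + 1) := Nat.one_le_pow _ _ (by omega)
  obtain ⟨κ₀, C, KE, Φ₀, hκ, hC, hKE, hΦ, hN1, hE, -, ht⟩ := exists_common_letters (Lc := Lc) hLc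
  -- the three cells, legs in the `respStep 1 (Lc^(k+1))` spelling
  have hcells := contact_legChain_ff_eq_cells hLc hrr 0 k κ' u' x' z' α β
  simp only [respStep_pow_zero] at hcells
  rw [hcells]
  clear hcells
  -- names
  set N : ℕ := Lc ^ (k + 1) with hNdef
  set T : LegFam 3 := legChain (respStepBmSeq (d := 3) (toSite rr) Lc) 0 k with hT
  set B : LegFam 3 := respStep (d := 3) 1 (Lc ^ (k + 1)) with hB
  set ψα : Form0 (3 + 1) ℝ := Psi (toSite rr) Lc 0 k (delta1 α x') - bmGaugeAt (toSite rr) (B α x') Lc with hψα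
  set ψβ : Form0 (3 + 1) ℝ := Psi (toSite rr) Lc 0 k (delta1 β z') - bmGaugeAt (toSite rr) (B β z') Lc with hψβ
  set ψκ : Form0 (3 + 1) ℝ := Psi (toSite rr) Lc 0 k (delta1 κ' u') - bmGaugeAt (toSite rr) (B κ' u') Lc with hψκ
  set tα : Form1 (3 + 1) ℝ := contourSumAdj N (fun l y => wΦ (N := N) (d := 3) l α (y - x')) with htα
  set tβ : Form1 (3 + 1) ℝ := contourSumAdj N (fun l y => wΦ (N := N) (d := 3) l β (y - z')) with htβ
  set tκ : Form1 (3 + 1) ℝ := contourSumAdj N (fun l y => wΦ (N := N) (d := 3) l κ' (y - u')) with htκ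
  -- letters, qualitatively: boundedness and summability
  set Eψ : ℝ := 2 * (8 * (Lc : ℝ) * C * ((Lc : ℝ) ^ (5 * (k + 1)))⁻¹) * (Lc : ℝ) ^ k with hEψ
  set CB : ℝ := C * ((Lc : ℝ) ^ (5 * (k + 1)))⁻¹ with hCB
  set τ : ℝ := (N : ℕ) * (Φ₀ * ((Lc : ℝ) ^ (8 * (k + 1)))⁻¹) * Real.exp κ₀ with hτ
  have hEψ0 : 0 ≤ Eψ := by positivity
  have hCB0 : 0 ≤ CB := by positivity
  have hτ0 : 0 ≤ τ := by positivity
  have hψenv : ∀ (μ : Fin (3 + 1)) (z : Site (3 + 1)) (u : Site (3 + 1)),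
      |Psi (toSite rr) Lc 0 k (delta1 μ z) u - bmGaugeAt (toSite rr) (B μ z) Lc u| ≤ Eψ * Real.exp (-(κ₀ * supNorm (quo N u - z))) := by
    intro μ z u
    have h := abs_gauge_le hLc hC hN1 hrr k μ z u
    simp only [respStep_pow_zero] at h
    exact h
  have hψb : ∀ (μ : Fin (3 + 1)) (z : Site (3 + 1)) (u : Site (3 + 1)),
      |Psi (toSite rr) Lc 0 k (delta1 μ z) u - bmGaugeAt (toSite rr) (B μ z) Lc u| ≤ Eψ :=
    fun μ z u => abs_le_of_env (L := N) hκ.le hEψ0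
      (g := fun u => Psi (toSite rr) Lc 0 k (delta1 μ z) u - bmGaugeAt (toSite rr) (B μ z) Lc u) (hψenv μ z) u
  have hTeq : ∀ (μ : Fin (3 + 1)) (z : Site (3 + 1)) (κ : Fin (3 + 1)) (u : Site (3 + 1)),
      T μ z κ u = B μ z κ u + ((Psi (toSite rr) Lc 0 k (delta1 μ z) - bmGaugeAt (toSite rr) (B μ z) Lc) (u + unitVec κ)
        - (Psi (toSite rr) Lc 0 k (delta1 μ z) - bmGaugeAt (toSite rr) (B μ z) Lc) u) := by
    intro μ z κ u
    have h := legChain_apply_eq hrr k μ z κ u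
    simp only [respStep_pow_zero] at h
    exact h
  have hBenv : ∀ (μ : Fin (3 + 1)) (z : Site (3 + 1)) (κ : Fin (3 + 1)) (u : Site (3 + 1)),
      |B μ z κ u| ≤ CB * Real.exp (-(κ₀ * supNorm (quo N u - z))) := by
    intro μ z κ u
    have h := hN1 0 k μ z κ u
    simp only [respStep_pow_zero] at h
    exact h
  have hBb : ∀ (μ : Fin (3 + 1)) (z : Site (3 + 1)) (κ : Fin (3 + 1)) (u : Site (3 + 1)), |B μ z κ u| ≤ CB :=
    fun μ z => abs_le_of_env₁ hκ.le hCB0 (hBenv μ z)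
  have hBs : ∀ (μ : Fin (3 + 1)) (z : Site (3 + 1)) (κ : Fin (3 + 1)), Summable (B μ z κ) :=
    fun μ z => summable_of_env₁ hN1' hκ (hBenv μ z)
  have hTs : ∀ (μ : Fin (3 + 1)) (z : Site (3 + 1)) (b : Fin (3 + 1)), Summable (T μ z b) :=
    fun μ z b => summable_of_env hN1' hκ (fun u => hE rr hrr k μ z b u)
  have hTb : ∀ (μ : Fin (3 + 1)) (z : Site (3 + 1)) (κ : Fin (3 + 1)) (u : Site (3 + 1)), |T μ z κ u| ≤ CB + 2 * Eψ := by
    intro μ z κ u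
    rw [hTeq]
    have h1 := hBb μ z κ u
    have h2 := hψb μ z (u + unitVec κ)
    have h3 := hψb μ z u
    have h4 := abs_add_le (B μ z κ u) ((Psi (toSite rr) Lc 0 k (delta1 μ z) - bmGaugeAt (toSite rr) (B μ z) Lc) (u + unitVec κ)
        - (Psi (toSite rr) Lc 0 k (delta1 μ z) - bmGaugeAt (toSite rr) (B μ z) Lc) u)
    have h5 := abs_sub ((Psi (toSite rr) Lc 0 k (delta1 μ z) - bmGaugeAt (toSite rr) (B μ z) Lc) (u + unitVec κ))
      ((Psi (toSite rr) Lc 0 k (delta1 μ z) - bmGaugeAt (toSite rr) (B μ z) Lc) u)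
    simp only [Pi.sub_apply] at h4 h5 ⊢
    linarith
  have hMT : ∀ (μ : Fin (3 + 1)) (z : Site (3 + 1)),
      curvAdj (curv (T μ z)) = contourSumAdj N (fun l y => wΦ (N := N) (d := 3) l μ (y - z)) :=
    fun μ z => curvAdj_curv_legChain_zero_eq_contourSumAdj hrr k μ z
  have hMB : ∀ (μ : Fin (3 + 1)) (z : Site (3 + 1)),
      curvAdj (curv (B μ z)) = contourSumAdj N (fun l y => wΦ (N := N) (d := 3) l μ (y - z)) :=
    fun μ z => curvAdj_curv_respStep_one_eq_contourSumAdj (N := N) μ z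
  have htenv : ∀ (μ : Fin (3 + 1)) (z : Site (3 + 1)) (κ : Fin (3 + 1)) (u : Site (3 + 1)),
      |contourSumAdj N (fun l y => wΦ (N := N) (d := 3) l μ (y - z)) κ u| ≤ τ * Real.exp (-(κ₀ * supNorm (quo N u - z))) := by
    intro μ z κ u; have h := ht k μ z κ u; rw [hτ]; exact h
  have htb : ∀ (μ : Fin (3 + 1)) (z : Site (3 + 1)) (κ : Fin (3 + 1)) (u : Site (3 + 1)),
      |contourSumAdj N (fun l y => wΦ (N := N) (d := 3) l μ (y - z)) κ u| ≤ τ :=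
    fun μ z => abs_le_of_env₁ hκ.le hτ0 (htenv μ z)
  have hts : ∀ (μ : Fin (3 + 1)) (z : Site (3 + 1)) (κ : Fin (3 + 1)),
      Summable (contourSumAdj N (fun l y => wΦ (N := N) (d := 3) l μ (y - z)) κ) :=
    fun μ z => summable_of_env₁ hN1' hκ (htenv μ z)
  -- the three cells as atoms
  rw [cellL_eq_atoms (T₃ := T β z') (T₁ := T κ' u') (ψ := ψα) (B₁ := B κ' u') (B₃ := B β z') (lam₁ := ψκ) (lam₃ := ψβ) (M₁ := tκ) (M₃ := tβ)
      (hTs β z') (hts κ' u') (hts β z') (hψb α x') (hTb κ' u') (hBb κ' u') (hBb β z') (hψb κ' u') (hψb β z') (htb κ' u')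
      (hTeq κ' u') (hTeq β z') (hMT κ' u') (hMT β z'),
    cellR_eq_atoms (B₃ := B α x') (T₁ := T κ' u') (ψ := ψβ) (B₁ := B κ' u') (lam₁ := ψκ) (M₁ := tκ) (M₃ := tα)
      (hBs α x') (hts α x') (hψb β z') (hTb κ' u') (hBb κ' u') (hψb κ' u') (htb κ' u') (hTeq κ' u') (hMT κ' u') (hMB α x'),
    cellIdx_eq' (TR := B β z') (TL := B α x') (ψ := ψκ) (hBs β z') (hψb κ' u') (hBb α x')
      (fun b z => by rw [hMB α x']; exact htb α x' b z),
    hMB α x', hMB β z']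

end Three

end Summit.QuantumFields.BalabanUV.Beta.GAN24.ContactCauchyCells

end
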